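import Literature.NumberTheory.EllipticCurves.Kato2004.LocalIwasawaCohomology
import HarnessLib

/-!
# Kato 2004 (Astérisque 295) §12.2 (12.2.3), first clause: the local Iwasawa cohomology `𝐇¹_loc(T_pE)` is a
# finitely generated `Λ`-module — NAMED FACT, in the tree's `Δ`-trivial reading of `LocalIwasawaCohomology.lean`

Topic `NumberTheory/EllipticCurves`, sub-directory `Kato2004` (namespace = path).  Seat `bsd-2adic-conv-1` GEN 27 (cell
`pub/bsd-2adic`; crux `OrdLambdaHalfAtTwo` = item 19556, line `kato_determinant_greenberg_two` v4, lead g1's FREE WORK F3: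
"(12.2.3) `Module.Finite Λ J.H` at `v = 2` … as a Literature fact with Kato p. 220 locator").  The pinned local carrier
`LocalIwasawaH1Data κ v T γᵥ` (`LocalIwasawaCohomology.lean`, §2; existence and uniqueness PROVED there) deliberately vendors no
clause of (12.2.3) ("Consumers needing (12.2.3) at `p = 2` must vendor it as a named fact with the READING above", its module
docstring §NOT here).  This file is that named fact, for the Tate module `T = T_pE|_{Γ_{ℚ_v}}` of an elliptic curve over `ℚ`
at the place `v ∣ p` (the only instance the consumers use), every prime `p`.

## The printed statement (K. Kato, Astérisque 295 (2004), §12.2, printed p. 220 = store `paper:doi-10-24033-ast-639` p. 105,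
## re-read 2026-08-28)

"On the other hand, for a finitely generated `ℤ_p`-module `T` endowed with a continuous action of `Gal(ℚ̄_p/ℚ_p)`, let
`𝐇^q_loc(T) = lim←_n H^q(ℚ_p(ζ_{p^n}), T)`.  Then the following are known: (12.2.3) `𝐇^q_loc(T) = 0` if `q ≠ 1, 2`,
`𝐇¹_loc(T)` and `𝐇²_loc(T)` are finitely generated `ℤ_p[[G_∞]]`-modules, and `dim(𝐇¹_loc(T)_𝔮) = rank_{ℤ_p}(T)`,
`dim(𝐇²_loc(T)_𝔮) = 0` for any prime ideal `𝔮` of `ℤ_p[[G_∞]]` of height `0`."  (`G_∞ = Gal(ℚ(ζ_{p^∞})/ℚ)`; the source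
of "known" is Perrin-Riou's local Iwasawa theory [Pe2] = [PerrinRiou1994Invent].)

## READING (the `Δ`-trivial tower; verbatim the convention of `LocalIwasawaCohomology.lean` and of the global twin
## `Kato2004.thm12_4` in `IwasawaCohomology.lean`, whose READING AT `p = 2` (β₂) this file follows clause by clause)

The tree's `J : LocalIwasawaH1Data κ v T γᵥ` for the CYCLOTOMIC `κ` and the place `v ∣ p` is
`𝐇¹_{loc,Γ}(T) := lim←_n H¹(ℚ_{n,v}, T)` over the layers `ℚ_{n,v} = ℚ_n·ℚ_v` of the cyclotomic `ℤ_p`-extension of `ℚ_v = ℚ_p`,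
a `Λ = ℤ_p⟦X⟧`-module with `X = conj_{γᵥ} − 1` for `γᵥ` restricting to a topological generator (`proj_T_smul`); Kato's
`𝐇¹_loc(T)` is over `ℚ_p(ζ_{p^{n+1}}) = ℚ_{n,v}(μ_p)` (`p` odd) / `ℚ_2(ζ_{2^{n+2}}) = ℚ_{n,2}(i)` (`p = 2`), a module over
`ℤ_p[[G_∞]] = ℤ_p[Δ]⟦X⟧`, free of rank `#Δ` over `ℤ_p⟦X⟧`.  For `p` odd, `𝐇¹_{loc,Γ}(T) = e₀·𝐇¹_loc(T)` is a direct factor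
(restriction–corestriction with `#Δ = p − 1 ∈ ℤ_pˣ`), so finite generation over `ℤ_p[[G_∞]]` gives finite generation of
the factor over `ℤ_p⟦X⟧`.  AT `p = 2` (`Δ = {1, c}` of order `2`, no idempotent): for `T = T₂E|_{Γ_{ℚ₂}}` the restrictions
`H¹(ℚ_{n,2}, T₂E) → H¹(ℚ_{n,2}(i), T₂E)` are injective — inflation–restriction, kernel `H¹(Δ, (T₂E)^{Gal(ℚ̄₂/ℚ_{n,2}(i))})` and
`(T₂E)^{Gal(ℚ̄₂/ℚ_{n,2}(i))} = lim←_m E(ℚ_{n,2}(i))[2^m] = 0` because the torsion of `E` over the FINITE extension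
`ℚ_{n,2}(i)/ℚ₂` is finite (Lutz–Mattuck: `E(L) ≅ ℤ_p^{[L:ℚ_p]} ⊕` finite for `L/ℚ_p` finite; exactly the sentence "`E(K_n)[2^∞]`
being finite" of (β₂.1) in `IwasawaCohomology.lean`) — and commute with the trace maps of the two towers
(`ℚ_{n+1,2}(i) = ℚ_{n,2}(i)·ℚ_{n+1,2}`), so
`𝐇¹_{loc,Γ}(T₂E) ↪ 𝐇¹_loc(T₂E)` equivariantly for `ℤ₂⟦X⟧ = ℤ₂[[Γ′]] ⊂ ℤ₂[[G_∞]]`; a `ℤ₂⟦X⟧`-submodule of a module finitely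
generated over `ℤ₂[[G_∞]]` (hence over the Noetherian ring `ℤ₂⟦X⟧`, over which `ℤ₂[[G_∞]]` is free of rank `2`) is finitely
generated.  Hence the `def` below — quantified over every prime — is a SPECIAL CASE of print at every `p`, never stronger.
-- TODO(general form): Kato's full statement — arbitrary finitely generated `ℤ_p`-modules `T` with continuous
-- `Gal(ℚ̄_p/ℚ_p)`-action, all `Δ`-components, `𝐇²_loc`, the vanishing for `q ≠ 1, 2`, and the generic ranks
-- `dim(𝐇¹_loc(T)_𝔮) = rank T`, `dim(𝐇²_loc(T)_𝔮) = 0`.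

HONEST FRAMING: a named fact (`def … : Prop`, D-0014); nothing is asserted; no `_holds` is attempted here (a proof needs the
finiteness of local Galois cohomology with `ℤ_p`-coefficients and topological Nakayama over `Λ`, neither in the tree); no
instance, no notation; nothing here is specific to any summit; BSD is not proved by any of this.

## References
* K. Kato, *p-adic Hodge theory and values of zeta functions of modular forms*, Astérisque 295 (2004), §12.2 (12.2.3), p. 220.
  [Kato2004Asterisque]
* B. Perrin-Riou, *Théorie d'Iwasawa des représentations p-adiques sur un corps local*, Invent. Math. 115 (1994) (Kato's [Pe2]).
  [PerrinRiou1994Invent]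
* J. Silverman, *The Arithmetic of Elliptic Curves*, GTM 106 (2009), VII.6 (structure of `E(L)` for `L/ℚ_p` finite:
  finite torsion). [SilvermanAEC2009]
-/

open scoped NumberField
open Field IsDedekindDomain
open Literature.NumberTheory.GaloisRepresentations
open Literature.NumberTheory.EllipticCurves Literature.NumberTheory.EllipticCurves.Kato2004
open Literature.NumberTheory.EllipticCurves.Kato2004.EulerSystemValues

namespace Literature.NumberTheory.EllipticCurves.Kato2004

/-- **Kato 2004, §12.2 (12.2.3), first clause, for `T = T_pE|_{Γ_{ℚ_v}}` at `v ∣ p` (Δ-trivial reading).**  For every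
elliptic curve `E/ℚ` (`W`), every prime `p`, the cyclotomic `ℤ_p`-extension `κ` of `ℚ`, the place `v` of `ℚ` above `p`,
any `γᵥ ∈ Γ_{ℚ_v}` restricting to a topological generator of `Gal(ℚ_∞/ℚ)`, and any pinned local Iwasawa-cohomology datum
`J` (`𝐇¹_{loc,Γ}(T_pE) = lim←_n H¹(ℚ_{n,v}, T_pE)` as a `Λ = ℤ_p⟦X⟧`-module, `X = conj_{γᵥ} − 1`; such data exist and are
unique up to unique isomorphism, `nonempty_localIwasawaH1Data`, `LocalIwasawaH1Data.exists_linearEquiv`):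
**`𝐇¹_{loc,Γ}(T_pE)` is a finitely generated `Λ`-module** ("`𝐇¹_loc(T)` [is a] finitely generated `ℤ_p[[G_∞]]`-module").
At `p = 2` this is the special case explained in the module docstring (READING AT `p = 2`: restriction to Kato's tower
`ℚ_2(ζ_{2^{n+2}}) = ℚ_{n,2}(i)` is injective since `E(ℚ_{n,2}(i))[2^∞]` is finite, and `ℤ₂⟦X⟧` is Noetherian).
Consumer: the field `finiteHl` of `TwoAdicKatoDeterminant.PinnedKatoGreenbergDatum` (crux `OrdLambdaHalfAtTwo`, `p = 2`).
-- TODO(general form): arbitrary `T`, all `Δ`-components, `𝐇²_loc`, vanishing for `q ≠ 1,2`, generic ranks.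
[cite: Kato2004Asterisque, §12.2 (12.2.3) (p. 220)] -/
def localIwasawaH1_tateRep_moduleFinite : Prop :=
  ∀ (W : WeierstrassCurve ℚ) [W.IsElliptic] (p : ℕ) [Fact p.Prime] [ContinuousSMul ℤ_[p] (W.tateModule p)]
    (κ : ZpExtension ℚ p) (v : HeightOneSpectrum (𝓞 ℚ)) (γᵥ : absoluteGaloisGroup (v.adicCompletion ℚ)),
    κ.IsCyclotomic → ((p : ℕ) : 𝓞 ℚ) ∈ v.asIdeal →
    κ.IsTopGenerator (resGalOfEmb (closureEmb (K := ℚ) (v.adicCompletion ℚ)) γᵥ) →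
    ∀ J : LocalIwasawaH1Data κ v ((tateRep W p).toLocal v) γᵥ, Module.Finite (IwasawaAlgebra p) J.H

end Literature.NumberTheory.EllipticCurves.Kato2004
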